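import Summits.QuantumFields.YangMills.Theorems.BalabanUVNodesN15PerCubeGreenJetKnit
import Summits.QuantumFields.YangMills.Theorems.BalabanUVNodesN15PerCubeGreenCovDDictionary
import Summits.QuantumFields.YangMills.Theorems.BalabanUVNodesN15TwoSpacingGluingCovariant
import HarnessLib

/-!
# N15 = NE2, road (c) — PROGRAMME (PC), (PC-A′) «the COVARIANT GRADIENT entries of [B9] (3.42) in per-cube gauges», VI: ★★★ THE COVARIANT DERIVATIVE THROUGH THE SCALAR COVARIANT
# GREEN's FUNCTION KNIT — n15-c∕273's left factor DISCHARGED for `D = D_{U,μ}` (n15-b `covD`): the gauge covariance by n15-c∕270 (`v_k = W_k`), the transport species `n(R^{w_k} − 1)`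
# SPLIT under ∕ beyond the shifted cut, its row under the cut = 52's `a⁺`-letter of the transformed bond variables ONE STEP BEFORE the cut box (dag-n15-c g26, n15-c∕274)

Cell `pub-ymgap`, seat `pub-ymgap-dag-n15-c` (generation g26; R134 (a), s1; HUMAN RULING D-0062).  `bears_on: R4∕N15 · K3⁸ SpineGivenEndpointR13SepCoPHV (stmt-QuantumFields-27366)`;
filed `--kind proof --supports stmt-QuantumFields-27366 --as helper` — COUNT-NEUTRAL.  One theorem, 0 `sorry`, no `def`.  Imports BY NAME n15-c∕273 `…PerCubeGreenJetKnit` (`uN_scGluedJet_spec`),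
n15-c∕270 `…PerCubeGreenCovDDictionary` (`covD_comp_mmulOp_transpose`, `covD_eq_fgrad_add`), n15-c `…TwoSpacingGluingCovariant` (`covD_comp_mulOp_scalar`), and through them dag-n15-w2
`uN_siteGauge_orthogonal`, `uN_trGaugeActFwd_conj_field`, n15-b `covD`, dag-n15-c `hasMaj_pull_comp`, `mmulOp_add`, `hasMaj_mmulOp`, `mem_cubeBlocks_of_mem_inner`, n15-c∕263
`scChi_ne_zero_nbhd`.  Nothing in the tree is modified.  GENERATED by the seat's `buildCD.py` (273's template with the jet block discharged in place; the cover's data reused).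

THE THEOREM `uN_scGluedCovD_spec`.  262's data and displayed rows VERBATIM plus, for a direction `μ`, ONE displayed letter: the row sums of the forward transport coefficient
`a⁺_μ = n(R⁺_μ − 1)` of the transformed bond variables `u_kU_μu_k(· + e_μ)ᴴ` at every site ONE STEP BEFORE the cut box (`χ_k(x + e_μ) ≠ 0`) are `≤ r_A` — the same (3.35) letter 263
produces from `Reg335Cube` on the box (which contains the cut box and its one-step neighbours, 263 `scChi_ne_zero_nbhd`) ⟹
`D_{U,μ}∘scGlued ≤ (1·(1 + r_Ae^{δ}·c_r) + π)·B·e^{−(δ∕16)|y−y′|_T}`, `D_{U,μ} = covD n⁻¹ (coordMat e Ad_{U_μ}) (· + e_μ)`.  Inside: `v_k := W_k = coordMat e Ad_{u_k}` (orthogonal,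
`uN_siteGauge_orthogonal`), covariance 270 + `(R_U)^{W_k} = R_{U^{u_k}}` (`uN_trGaugeActFwd_conj_field`), `covD n⁻¹ R^{w_k} = ∇^n_μ + M_{a⁺}∘τ_μ^*` (270), `a⁺ = a⁺·1_B + a⁺·1_{Bᶜ}`,
`B = {x | χ_k(x + e_μ) ≠ 0}`: the far part dies on `M_{χ_k}`, the near part `= τ_μ^*∘M_{a⁺1_B∘τ_μ⁻¹}` has rows `1_{S_k}(y)·r_Ae^{δ}e^{−δd}` (row sums under the cut, blocks of the cut box,
one-step shift: the point before the cut box lies in the (3.35) box ⊂ the cube `S_k`), Leibniz `h^s = h∘τ_μ`, `dh = ∇_μh` (`|∇h| ≤ π∕L^m ≤ π`).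

HONEST FRAMING ∕ LIMITS.  As n15-c∕262∕273: composition of LANDED theorems on MODEL carriers; `U` live only through displayed hypotheses; the SHAPE of [B9] (3.42)'s gradient entry
with per-cube gauges at MODEL level, NOT the printed theorem; nothing of [B5]∕[B6]∕[B9] asserted.  NE2⁺ NOT PRINTED, NOT proved; N15 of record untouched (DISCHARGED AS CONSUMED,
p687738); K3⁸ OPEN; counts of record UNMOVED (typed 28∕28 · discharged 8∕27); one finite 𝕋⁴ at fixed ε per index — NOT infinite volume, NOT OS on ℝ⁴, NOT a mass gap, NOT Clay.
Restate-immune (no Theses import).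
-/

noncomputable section

open scoped BigOperators Matrix Matrix.Norms.Frobenius

namespace Summit.QuantumFields.YangMills.BalabanUVNodes.N15.Gluing

open Real
open Literature.MathematicalPhysics.QuantumFieldTheory.Balaban1983to89
open Literature.MathematicalPhysics.QuantumFieldTheory.Balaban1983to89.B5Prop11Plancherel (Tor fine unitVec)
open Literature.MathematicalPhysics.QuantumFieldTheory.Balaban1983to89.B11SectG (BlockNorm HasMaj RowSum hasMaj_zero)
open Literature.MathematicalPhysics.QuantumFieldTheory.Balaban1983to89.B6RandomWalk (Triangle254)
open Literature.MathematicalPhysics.QuantumFieldTheory.Balaban1983to89.B6Prop26Gluing (mulOp mulOp_apply ind ind_nonneg ind_le_one)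
open Literature.MathematicalPhysics.QuantumFieldTheory.Balaban1983to89.B6UnitTorusCarrier (unitTorusGeo triangle254_unitTorusGeo rowSum_unitTorusGeo unitTorusGeo_dist_nonneg
  unitTorusGeo_dist_symm unitTorusGeo_dist_self)
open Literature.MathematicalPhysics.QuantumFieldTheory.Balaban1983to89.B5SiteBridgeP12 (MP)
open Literature.MathematicalPhysics.QuantumFieldTheory.King1986 (aK aK_pos aK_le)
open Literature.MathematicalPhysics.QuantumFieldTheory.King1986.Torus (blockOf tdistT tdistT_nonneg tdistT_symm)
open Literature.Barriers.QuantumFields (traceForm)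
open Summit.QuantumFields.YangMills.BalabanUVNodes.N15.BackgroundLayer (fgrad fgradAdj bgrad fgrad_apply fgradAdj_apply bgrad_apply stack projO bgPropV covLapM tCoefA tCoefC unstackM)
open Summit.QuantumFields.YangMills.BalabanUVNodes.N15.VectorPiece (bshiftEquiv bshiftEquiv_apply tensorId tdistT_blockOf_sub_unitVec_le)
open Summit.QuantumFields.YangMills.BalabanUVNodes.N15.MatrixSpecies (mmulOp coordMat liftBlk liftEquiv liftEquiv_apply liftEquiv_symm_apply)
open Summit.QuantumFields.YangMills.BalabanUVNodes.N15.TwoGrid (paramsOf chiCube cubeBlocks chiCube_of_not_mem abs_chiCube_le_one)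
open Summit.QuantumFields.YangMills.BalabanUVNodes.N15.CurvedSpecies (gaugePair gaugePair_inl trGaugeActFwd uN_siteGauge_orthogonal uN_trGaugeActFwd_conj_field)
open Summit.QuantumFields.YangMills.BalabanUVNodes.N15.BackgroundLayer (tCoefA_inl)
open Summit.QuantumFields.YangMills.BalabanUVNodes.N15.VectorPiece (hasMaj_pull_comp)
open Summit.QuantumFields.YangMills.BalabanUVNodes.N15.BackgroundLayer (mmulOp_add)
open Summit.QuantumFields.YangMills.BalabanUVNodes.N15.MatrixSpecies (covD covD_apply mmulOp_apply hasMaj_mmulOp)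
open Literature.MathematicalPhysics.QuantumFieldTheory.Balaban1983to89.T4EtaRateCoeffDefect (pull pull_apply diagK)
open Literature.MathematicalPhysics.QuantumFieldTheory.Balaban1983to89.B6Prop26Gluing (ind_of_mem ind_of_not_mem)

variable {d : ℕ}

/-! ## The scalar covariant Green's function knit with a left factor at the cover, one grid -/

section Knit

variable {L : ℕ} [NeZero L]

set_option maxHeartbeats 400000 in
set_option maxRecDepth 2048 in
/-- ★★★ **THE COVARIANT DERIVATIVE THROUGH THE SCALAR COVARIANT GREEN's FUNCTION KNIT**: n15-c∕262's data and displayed rows verbatim plus, for a direction `μ`, the row letter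
`r_A` of the forward transport coefficient `a⁺_μ` of the transformed bond variables one step before the cut box ⟹ `covD n⁻¹ (coordMat e Ad_{U_μ}) (· + e_μ)∘scGlued ≤
(1·(1 + r_Ae^{δ}c_r) + π)·B·e^{−(δ∕16)|y−y′|_T}` — n15-c∕273 with the left factor's data DISCHARGED (270's gauge law and species split, the cut∕far split of `a⁺`, the one-step shift row).
MODEL carriers; the SHAPE of [B9] (3.42)'s gradient entry with per-cube gauges, NOT the printed theorem.
[cite: Balaban1985BackgroundPropagators, (3.42) p.397, (3.50)–(3.52) p.400, (3.34)–(3.35) p.396, Thm 3.7 (3.90) p.409 (shape ∕ mechanism); Balaban1984PropagatorsII, (2.91)–(2.93) p.239, (2.133)–(2.136) p.247] -/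
theorem uN_scGluedCovD_spec (hL : Odd L ∧ 1 < L) (hL7 : 7 ≤ L) {a₀ : ℝ} (ha₀ : 0 < a₀) (ι : Type) [Fintype ι] [DecidableEq ι] :
    ∃ δ w₀ R₀ θ₀ B cR : ℝ, 0 < δ ∧ 0 < R₀ ∧ 0 < θ₀ ∧ 0 < B ∧ 0 ≤ cR ∧
      ∀ (mv kk : ℕ), 1 ≤ kk → w₀ ≤ ((L ^ mv : ℕ) : ℝ) →
      ∀ {mm : Type} [Fintype mm] [DecidableEq mm] (e : Matrix mm mm ℂ ≃L[ℝ] (ι → ℝ)), (∀ A B : Matrix mm mm ℂ, traceForm A B = e A ⬝ᵥ e B) →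
      ∀ (u : (Fin (d + 1) → ZMod (2 * L)) → ScX d L mv kk hL → Matrix mm mm ℂ), (∀ k x, (u k x)ᴴ * u k x = 1) →
      ∀ (U : Fin (d + 1) → ScX d L mv kk hL → Matrix mm mm ℂ) (P : (ScX d L mv kk hL × ι → ℝ) →ₗ[ℝ] (ScX d L mv kk hL × ι → ℝ))
        (NV : (Fin (d + 1) → ZMod (2 * L)) → (ScX d L mv kk hL × ι → ℝ) →ₗ[ℝ] (ScX d L mv kk hL × ι → ℝ)) (rV RN θF : ℝ),
        0 ≤ rV → 0 ≤ RN → 0 ≤ θF → rV * (1 + Fintype.card (Fin (d + 1) ⊕ Fin (d + 1))) + RN ≤ R₀ → θF ≤ θ₀ →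
        (∀ k, mmulOp (fun x => coordMat e (ContinuousLinearMap.mulLeftRight ℝ (Matrix mm mm ℂ) (u k x) (u k x)ᴴ)) ∘ₗ P ∘ₗ mmulOp (fun x => (coordMat e (ContinuousLinearMap.mulLeftRight ℝ (Matrix mm mm ℂ) (u k x) (u k x)ᴴ))ᵀ) = (scQQ d L mv kk hL (aK a₀ (L : ℝ) kk * (((L ^ kk : ℕ) : ℝ)) ^ (d + 1)) ι) - NV k) →
        (∀ k x, scChi d L mv kk hL k x ≠ 0 → ∀ i, ∑ j, |tCoefC ((((L ^ kk : ℕ) : ℝ))⁻¹) (gaugePair (scShift d L mv kk hL) fun μ x => coordMat e (ContinuousLinearMap.mulLeftRight ℝ (Matrix mm mm ℂ) (u k x * U μ x * (u k (scShift d L mv kk hL μ x))ᴴ) (u k x * U μ x * (u k (scShift d L mv kk hL μ x))ᴴ)ᴴ)) x i j| ≤ rV) →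
        (∀ k j' x, scChi d L mv kk hL k x ≠ 0 → ∀ i, ∑ j, |tCoefA ((((L ^ kk : ℕ) : ℝ))⁻¹) (gaugePair (scShift d L mv kk hL) fun μ x => coordMat e (ContinuousLinearMap.mulLeftRight ℝ (Matrix mm mm ℂ) (u k x * U μ x * (u k (scShift d L mv kk hL μ x))ᴴ) (u k x * U μ x * (u k (scShift d L mv kk hL μ x))ᴴ)ᴴ)) j' x i j| ≤ rV) →
        (∀ k, HasMaj (ScNorm d L mv kk hL ι) (ScNorm d L mv kk hL ι) (mulOp (fun p : ScX d L mv kk hL × ι => scPsi d L mv kk hL k p.1) ∘ₗ NV k ∘ₗ mulOp (fun p : ScX d L mv kk hL × ι => scChi d L mv kk hL k p.1)) (fun y y' => RN * Real.exp (-(δ * (unitTorusGeo L kk (cvM d L mv kk hL)).dist y y')))) →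
        (∀ k, HasMaj (ScNorm d L mv kk hL ι) (ScNorm d L mv kk hL ι) ((LinearMap.id - mulOp (fun p : ScX d L mv kk hL × ι => scPsi d L mv kk hL k p.1)) ∘ₗ NV k ∘ₗ mulOp (fun p : ScX d L mv kk hL × ι => scChi d L mv kk hL k p.1)) (fun y y' => θF * Real.exp (-(δ * (unitTorusGeo L kk (cvM d L mv kk hL)).dist y y')))) →
        ∀ (μ : Fin (d + 1)) (rA : ℝ), 0 ≤ rA →
        (∀ k x, scChi d L mv kk hL k (scShift d L mv kk hL μ x) ≠ 0 → ∀ i, ∑ j, |tCoefA ((((L ^ kk : ℕ) : ℝ))⁻¹) (gaugePair (scShift d L mv kk hL) fun ν x => coordMat e (ContinuousLinearMap.mulLeftRight ℝ (Matrix mm mm ℂ) (u k x * U ν x * (u k (scShift d L mv kk hL ν x))ᴴ) (u k x * U ν x * (u k (scShift d L mv kk hL ν x))ᴴ)ᴴ)) (Sum.inl μ) x i j| ≤ rA) →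
        HasMaj (ScNorm d L mv kk hL ι) (ScNorm d L mv kk hL ι)
          (covD ((((L ^ kk : ℕ) : ℝ))⁻¹) (fun x => coordMat e (ContinuousLinearMap.mulLeftRight ℝ (Matrix mm mm ℂ) (U μ x) (U μ x)ᴴ)) (scShift d L mv kk hL μ) ∘ₗ scGlued d L mv kk hL (aK a₀ (L : ℝ) kk * (((L ^ kk : ℕ) : ℝ)) ^ (d + 1)) ((((L ^ kk : ℕ) : ℝ))⁻¹) ι e u U P NV)
          (fun y y' => (1 * (1 + rA * Real.exp δ * cR) + π) * B * Real.exp (-(δ / 16 * (unitTorusGeo L kk (cvM d L mv kk hL)).dist y y'))) := by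
  obtain ⟨δ, w₀, R₀, θ₀, B, cR, hδ, hR₀, hθ₀, hB, hcR, H2⟩ := uN_scGluedJet_spec (d := d) hL hL7 ha₀ ι
  refine ⟨δ, max w₀ 2, R₀, θ₀, B, cR, hδ, hR₀, hθ₀, hB, hcR, fun mv kk hk hw₀ => ?_⟩
  intro mm _ _ e he u hu U P NV rV RN θF hrV hRN hθF0 hRle hθle hP hCloc hAloc hNVcut hfarN μ rA hrA hAμ
  have hL3 : 3 ≤ L := by omega
  have hw₀' : w₀ ≤ ((L ^ mv : ℕ) : ℝ) := (le_max_left _ _).trans hw₀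
  have hW2R : (2 : ℝ) ≤ ((L ^ mv : ℕ) : ℝ) := (le_max_right _ _).trans hw₀
  have hW2 : 2 ≤ L ^ mv := by exact_mod_cast hW2R
  have hw : 0 < L ^ mv := by omega
  have hW1 : (1 : ℝ) ≤ ((L ^ mv : ℕ) : ℝ) := by linarith only [hW2R]
  have hn : 1 ≤ L ^ kk := Nat.one_le_pow _ _ (by omega)
  have hM : ∀ ν, cvM d L mv kk hL ν = 2 * L * L ^ mv := MP_succ_eq L mv kk hL
  have hm₁ : 2 * L ^ mv ≤ coverMargin L mv := two_mul_le_coverMargin hL7 mv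
  have hfitI : coverMargin L mv - 2 * L ^ mv + (6 * L ^ mv + 1) ≤ L * L ^ mv := coverMargin_inner_fit hL7 hW2
  have hS0 : L * L ^ mv ≤ 2 * L * L ^ mv := by rw [mul_assoc]; omega
  have hK0 : 0 < 2 * L := by omega
  set η : ℝ := (((L ^ kk : ℕ) : ℝ))⁻¹ with hη
  set W : ℝ := ((L ^ mv : ℕ) : ℝ) with hWdef
  have hηinv : η⁻¹ = ((L ^ kk : ℕ) : ℝ) := by rw [hη, inv_inv]
  have hnr : (0 : ℝ) < ((L ^ kk : ℕ) : ℝ) := by exact_mod_cast hn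
  have hξS := scXi_shift_lift ι hM hw (d := d) (L := L) (mv := mv) (kk := kk) (hL := hL)
  have hs0 : (0 : ℝ) ≤ ((((L ^ kk : ℕ) : ℝ)) * ((L ^ mv : ℕ) : ℝ))⁻¹ := by positivity
  have hsW : |((L ^ kk : ℕ) : ℝ)| * (π * |((((L ^ kk : ℕ) : ℝ)) * ((L ^ mv : ℕ) : ℝ))⁻¹|) = π / W := by
    rw [abs_of_pos hnr, abs_of_nonneg hs0, mul_inv, hWdef]; field_simp
  -- the partition's letters and the site step (as in n15-c∕262)
  have hhabs : ∀ k x, |scH d L mv kk hL k x| ≤ 1 := fun k x => abs_hcube_le_one (2 * L) (scXi d L mv kk hL) k x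
  have hh1 : ∀ k μ p, |fgrad η⁻¹ (liftEquiv (scShift d L mv kk hL μ) ι) (fun p : ScX d L mv kk hL × ι => scH d L mv kk hL k p.1) p| ≤ π / W := by
    rw [hηinv]; exact fun k μ p => (abs_fgrad_hcube_le (2 * L) (fun ν (p : ScX d L mv kk hL × ι) => scXi d L mv kk hL ν p.1) (fun μ => liftEquiv (scShift d L mv kk hL μ) ι) hK0 hξS _ k μ p).trans hsW.le
  have hstep : ∀ μ x, (unitTorusGeo L kk (cvM d L mv kk hL)).dist (scBlk d L mv kk hL (scShift d L mv kk hL μ x)) (scBlk d L mv kk hL x) ≤ 1 := fun μ x => tdistT_scBlk_scShift_le μ x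
  -- THE LEFT FACTOR's DATA for `D = D_{U,μ}`: gauges, transformed transporters, the transport coefficient `a⁺_μ`, the shifted cut, near ∕ far parts
  classical
  have hug' : ∀ k x, (coordMat e (ContinuousLinearMap.mulLeftRight ℝ (Matrix mm mm ℂ) (u k x) (u k x)ᴴ))ᵀ * coordMat e (ContinuousLinearMap.mulLeftRight ℝ (Matrix mm mm ℂ) (u k x) (u k x)ᴴ) = 1 :=
    fun k x => (uN_siteGauge_orthogonal e (u k) he (hu k) x).2
  set Acf : (Fin (d + 1) → ZMod (2 * L)) → ScX d L mv kk hL → Matrix ι ι ℝ := fun k x => tCoefA η (gaugePair (scShift d L mv kk hL) fun ν x => coordMat e (ContinuousLinearMap.mulLeftRight ℝ (Matrix mm mm ℂ) (u k x * U ν x * (u k (scShift d L mv kk hL ν x))ᴴ) (u k x * U ν x * (u k (scShift d L mv kk hL ν x))ᴴ)ᴴ)) (Sum.inl μ) x with hAcf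
  set Bset : (Fin (d + 1) → ZMod (2 * L)) → Set (ScX d L mv kk hL) := fun k => {x | scChi d L mv kk hL k (scShift d L mv kk hL μ x) ≠ 0} with hBset
  set Anear : (Fin (d + 1) → ZMod (2 * L)) → ScX d L mv kk hL → Matrix ι ι ℝ := fun k x => if x ∈ Bset k then Acf k x else 0 with hAnear
  set Afar : (Fin (d + 1) → ZMod (2 * L)) → ScX d L mv kk hL → Matrix ι ι ℝ := fun k x => if x ∈ Bset k then 0 else Acf k x with hAfar
  have hsplit : ∀ k, Anear k + Afar k = Acf k := fun k => by
    funext x; simp only [hAnear, hAfar, Pi.add_apply]; split_ifs <;> simp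
  -- the covariance (270): `D_U∘M_{W_kᵀ} = M_{W_kᵀ}∘(∇_μ + M_{a⁺1_B}∘τ* + M_{a⁺1_{Bᶜ}}∘τ*)`
  have hDcov : ∀ k, covD η (fun x => coordMat e (ContinuousLinearMap.mulLeftRight ℝ (Matrix mm mm ℂ) (U μ x) (U μ x)ᴴ)) (scShift d L mv kk hL μ) ∘ₗ mmulOp (fun x => ((fun x => coordMat e (ContinuousLinearMap.mulLeftRight ℝ (Matrix mm mm ℂ) (u k x) (u k x)ᴴ)) x)ᵀ) =
      mmulOp (fun x => ((fun x => coordMat e (ContinuousLinearMap.mulLeftRight ℝ (Matrix mm mm ℂ) (u k x) (u k x)ᴴ)) x)ᵀ) ∘ₗ (Sum.elim (fun μ => fgrad η⁻¹ (liftEquiv (scShift d L mv kk hL μ) ι)) (fun μ => bgrad η⁻¹ (liftEquiv (scShift d L mv kk hL μ) ι)) (Sum.inl μ) +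
        mmulOp (Anear k) ∘ₗ pull ⇑(liftEquiv (scShift d L mv kk hL μ) ι) + mmulOp (Afar k) ∘ₗ pull ⇑(liftEquiv (scShift d L mv kk hL μ) ι)) := fun k => by
    rw [covD_comp_mmulOp_transpose (hug' k)]
    have hRw : (fun x => coordMat e (ContinuousLinearMap.mulLeftRight ℝ (Matrix mm mm ℂ) (u k x) (u k x)ᴴ) * coordMat e (ContinuousLinearMap.mulLeftRight ℝ (Matrix mm mm ℂ) (U μ x) (U μ x)ᴴ) *
        (coordMat e (ContinuousLinearMap.mulLeftRight ℝ (Matrix mm mm ℂ) (u k (scShift d L mv kk hL μ x)) (u k (scShift d L mv kk hL μ x))ᴴ))ᵀ) =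
        fun x => coordMat e (ContinuousLinearMap.mulLeftRight ℝ (Matrix mm mm ℂ) (u k x * U μ x * (u k (scShift d L mv kk hL μ x))ᴴ) (u k x * U μ x * (u k (scShift d L mv kk hL μ x))ᴴ)ᴴ) :=
      funext fun x => congrFun (congrFun (uN_trGaugeActFwd_conj_field e (scShift d L mv kk hL) (u := u k) (U := U) he (hu k)) μ) x
    rw [hRw]
    have hsp := covD_eq_fgrad_add (ι := ι) η⁻¹ (fun x => coordMat e (ContinuousLinearMap.mulLeftRight ℝ (Matrix mm mm ℂ) (u k x * U μ x * (u k (scShift d L mv kk hL μ x))ᴴ) (u k x * U μ x * (u k (scShift d L mv kk hL μ x))ᴴ)ᴴ)) (scShift d L mv kk hL μ)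
    rw [inv_inv] at hsp
    have hA : Acf k = fun x => η⁻¹ • (coordMat e (ContinuousLinearMap.mulLeftRight ℝ (Matrix mm mm ℂ) (u k x * U μ x * (u k (scShift d L mv kk hL μ x))ᴴ) (u k x * U μ x * (u k (scShift d L mv kk hL μ x))ᴴ)ᴴ) - 1) :=
      funext fun x => by simp only [hAcf, tCoefA_inl, gaugePair_inl]
    rw [hsp, Sum.elim_inl, add_assoc, ← LinearMap.add_comp, ← mmulOp_add, hsplit k, hA]
  -- the Leibniz rule through the partition (`h^s = h∘τ_μ`, `dh = ∇_μh`)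
  have hDleib : ∀ k, covD η (fun x => coordMat e (ContinuousLinearMap.mulLeftRight ℝ (Matrix mm mm ℂ) (U μ x) (U μ x)ᴴ)) (scShift d L mv kk hL μ) ∘ₗ mulOp (fun p : ScX d L mv kk hL × ι => scH d L mv kk hL k p.1) =
      mulOp (fun p : ScX d L mv kk hL × ι => scH d L mv kk hL k (scShift d L mv kk hL μ p.1)) ∘ₗ covD η (fun x => coordMat e (ContinuousLinearMap.mulLeftRight ℝ (Matrix mm mm ℂ) (U μ x) (U μ x)ᴴ)) (scShift d L mv kk hL μ) +
        mulOp (fun p : ScX d L mv kk hL × ι => η⁻¹ * (scH d L mv kk hL k (scShift d L mv kk hL μ p.1) - scH d L mv kk hL k p.1)) :=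
    fun k => covD_comp_mulOp_scalar η _ _ _
  have hhs : ∀ k (p : ScX d L mv kk hL × ι), |scH d L mv kk hL k (scShift d L mv kk hL μ p.1)| ≤ 1 := fun k p => hhabs k _
  have hdh : ∀ k (p : ScX d L mv kk hL × ι), |η⁻¹ * (scH d L mv kk hL k (scShift d L mv kk hL μ p.1) - scH d L mv kk hL k p.1)| ≤ π := fun k p => by
    have h := hh1 k μ p
    rw [fgrad_apply, liftEquiv_apply] at h
    exact h.trans (div_le_self pi_pos.le hW1)
  -- the far part dies on the cut
  have hPfar : ∀ k, (mmulOp (Afar k) ∘ₗ pull ⇑(liftEquiv (scShift d L mv kk hL μ) ι)) ∘ₗ mulOp (fun p : ScX d L mv kk hL × ι => scChi d L mv kk hL k p.1) = 0 := fun k => by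
    refine LinearMap.ext fun f => funext fun p => ?_
    simp only [LinearMap.comp_apply, LinearMap.zero_apply, Pi.zero_apply, mmulOp_apply, pull_apply, liftEquiv_apply, mulOp_apply]
    refine Finset.sum_eq_zero fun j _ => ?_
    by_cases hp : p.1 ∈ Bset k
    · have h0 : Afar k p.1 = 0 := by simp only [hAfar, if_pos hp]
      rw [h0, Matrix.zero_apply, zero_mul]
    · have h0 : scChi d L mv kk hL k (scShift d L mv kk hL μ p.1) = 0 := by
        by_contra h; exact hp h
      rw [h0, zero_mul, mul_zero]
  -- the near part: `M_{a⁺1_B}∘τ* = τ*∘M_{(a⁺1_B)∘τ⁻¹}`, row sums `≤ r_A` on the blocks of the cut box, the one-step shift lands in the cube `S_k`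
  have h7w : 7 ≤ L ^ mv := by
    rcases Nat.eq_zero_or_pos mv with h0 | hpos
    · subst h0; simp at hW2
    · exact hL7.trans (Nat.le_self_pow (Nat.pos_iff_ne_zero.mp hpos) L)
  have h7 : 7 * L ^ mv ≤ L * L ^ mv := Nat.mul_le_mul_right _ hL7
  have hcm : coverMargin L mv = (L * L ^ mv - 2 * L ^ mv - 1) / 2 := by
    show ((L - 2) * L ^ mv - 1) / 2 = _; rw [Nat.sub_mul]
  have hm₂ : 2 * L ^ mv + 1 ≤ coverMargin L mv := by omega
  have hfit₂ : coverMargin L mv - (2 * L ^ mv + 1) + (6 * L ^ mv + 3) ≤ L * L ^ mv := by omega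
  have hnear_mem : ∀ k x, x ∈ Bset k → scBlk d L mv kk hL x ∈ cvSk d L mv kk hL k := fun k x hx => by
    have h := (scChi_ne_zero_nbhd hL hL7 mv kk k (scShift d L mv kk hL μ x) hx).2.2 μ
    rw [Equiv.symm_apply_apply] at h
    exact Finset.mem_coe.mpr (mem_cubeBlocks_of_mem_inner hM hm₂ hfit₂ hS0 h)
  have hPsp : ∀ k, HasMaj (ScNorm d L mv kk hL ι) (ScNorm d L mv kk hL ι) (mmulOp (Anear k) ∘ₗ pull ⇑(liftEquiv (scShift d L mv kk hL μ) ι))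
      (fun y y' => ind (g := unitTorusGeo L kk (cvM d L mv kk hL)) (cvSk d L mv kk hL k) y * (rA * Real.exp δ * Real.exp (-(δ * (unitTorusGeo L kk (cvM d L mv kk hL)).dist y y')))) := fun k => by
    -- commute the coefficient through the shift
    have hcomm : mmulOp (Anear k) ∘ₗ pull ⇑(liftEquiv (scShift d L mv kk hL μ) ι) =
        pull ⇑(liftEquiv (scShift d L mv kk hL μ) ι) ∘ₗ mmulOp (fun x => Anear k ((scShift d L mv kk hL μ).symm x)) := by
      refine LinearMap.ext fun f => funext fun p => ?_
      simp only [LinearMap.comp_apply, mmulOp_apply, pull_apply, liftEquiv_apply, Equiv.symm_apply_apply]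
    rw [hcomm]
    -- the coefficient `(a⁺1_B)∘τ⁻¹`: row sums `≤ r_A·1_I` with `I` the blocks of the cut box
    have hI : HasMaj (ScNorm d L mv kk hL ι) (ScNorm d L mv kk hL ι) (mmulOp (fun x => Anear k ((scShift d L mv kk hL μ).symm x)))
        (diagK fun y => rA * ind (g := unitTorusGeo L kk (cvM d L mv kk hL))
          (↑(cubeBlocks (cvM d L mv kk hL) (coverCorner (cvM d L mv kk hL) (L ^ mv) L (2 * L ^ mv) k) (6 * L ^ mv + 1)) : Set (Tor (cvM d L mv kk hL))) y) := by
      refine hasMaj_mmulOp (g := unitTorusGeo L kk (cvM d L mv kk hL)) (scBlk d L mv kk hL) (fun y => mul_nonneg hrA (ind_nonneg _ _)) fun x i => ?_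
      by_cases hx : (scShift d L mv kk hL μ).symm x ∈ Bset k
      · have hx' : scChi d L mv kk hL k x ≠ 0 := by
          have h := hx; simp only [hBset, Set.mem_setOf_eq, Equiv.apply_symm_apply] at h; exact h
        have hmem : scBlk d L mv kk hL x ∈ (↑(cubeBlocks (cvM d L mv kk hL) (coverCorner (cvM d L mv kk hL) (L ^ mv) L (2 * L ^ mv) k) (6 * L ^ mv + 1)) : Set (Tor (cvM d L mv kk hL))) := by
          by_contra hn
          exact hx' (chiCube_of_not_mem (fun h => hn (Finset.mem_coe.mpr h)))
        rw [ind_of_mem hmem, mul_one]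
        simp only [hAnear, if_pos hx]
        exact hAμ k _ hx i
      · simp only [hAnear, if_neg hx, Matrix.zero_apply, abs_zero, Finset.sum_const_zero]
        exact mul_nonneg hrA (ind_nonneg _ _)
    refine hasMaj_pull_comp (g := unitTorusGeo L kk (cvM d L mv kk hL)) (liftBlk (scBlk d L mv kk hL) ι) ⇑(liftEquiv (scShift d L mv kk hL μ) ι)
      (fun y y' => mul_nonneg (ind_nonneg _ _) (mul_nonneg (mul_nonneg hrA (Real.exp_nonneg _)) (Real.exp_nonneg _))) (fun p y' => ?_) hI
    -- the one-step shift: if the shifted point's block carries the cut, the point lies in the (3.35) box ⊂ `S_k`, at block distance ≤ 1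
    show diagK _ (scBlk d L mv kk hL (scShift d L mv kk hL μ p.1)) y' ≤ _
    simp only [diagK]
    split_ifs with hy
    · by_cases hmem : scBlk d L mv kk hL (scShift d L mv kk hL μ p.1) ∈ (↑(cubeBlocks (cvM d L mv kk hL) (coverCorner (cvM d L mv kk hL) (L ^ mv) L (2 * L ^ mv) k) (6 * L ^ mv + 1)) : Set (Tor (cvM d L mv kk hL)))
      · have hχ : scChi d L mv kk hL k (scShift d L mv kk hL μ p.1) ≠ 0 := by
          show chiCube _ _ _ _ _ ≠ 0
          unfold chiCube; rw [if_pos (Finset.mem_coe.mp hmem)]; exact one_ne_zero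
        have hS : scBlk d L mv kk hL p.1 ∈ cvSk d L mv kk hL k := hnear_mem k p.1 hχ
        rw [← hy, ind_of_mem hmem, ind_of_mem hS, mul_one, one_mul, mul_assoc, ← Real.exp_add]
        refine le_mul_of_one_le_right hrA (Real.one_le_exp ?_)
        have hd1 : (unitTorusGeo L kk (cvM d L mv kk hL)).dist (scBlk d L mv kk hL p.1) (scBlk d L mv kk hL (scShift d L mv kk hL μ p.1)) ≤ 1 := by
          rw [unitTorusGeo_dist_symm]; exact hstep μ p.1
        nlinarith [hd1, hδ.le]
      · rw [← hy, ind_of_not_mem hmem, mul_zero]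
        exact mul_nonneg (ind_nonneg _ _) (mul_nonneg (mul_nonneg hrA (Real.exp_nonneg _)) (Real.exp_nonneg _))
    · exact mul_nonneg (ind_nonneg _ _) (mul_nonneg (mul_nonneg hrA (Real.exp_nonneg _)) (Real.exp_nonneg _))
  -- 273 at the cover with this data
  exact H2 mv kk hk hw₀' e he u hu U P NV rV RN θF hrV hRN hθF0 hRle hθle hP hCloc hAloc hNVcut hfarN (Sum.inl μ)
    (covD η (fun x => coordMat e (ContinuousLinearMap.mulLeftRight ℝ (Matrix mm mm ℂ) (U μ x) (U μ x)ᴴ)) (scShift d L mv kk hL μ)) (fun k x => coordMat e (ContinuousLinearMap.mulLeftRight ℝ (Matrix mm mm ℂ) (u k x) (u k x)ᴴ))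
    (fun k => mmulOp (Anear k) ∘ₗ pull ⇑(liftEquiv (scShift d L mv kk hL μ) ι)) (fun k => mmulOp (Afar k) ∘ₗ pull ⇑(liftEquiv (scShift d L mv kk hL μ) ι))
    (fun k x => scH d L mv kk hL k (scShift d L mv kk hL μ x)) (fun k x => η⁻¹ * (scH d L mv kk hL k (scShift d L mv kk hL μ x) - scH d L mv kk hL k x)) 1 π (rA * Real.exp δ)
    zero_le_one pi_pos.le (by positivity) hug' (by rw [hηinv] at hDcov; exact hDcov) hDleib hhs hdh hPsp hPfar

end Knit

end Summit.QuantumFields.YangMills.BalabanUVNodes.N15.Gluing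

end
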